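import Mathlib
import Summits.Ventures.HodgeRepro.Tier4.Common.SettingOfData
import Summits.Ventures.HodgeRepro.Tier4.Line1.SecondCountableGA
import Summits.Ventures.HodgeRepro.Tier4.Line1.LocallyCompactGA
import Summits.Ventures.HodgeRepro.Tier4.Line1.SigmaCompactGA
import Summits.Ventures.HodgeRepro.Tier4.Line4.AdaptedONBAdaptedClosed
import Summits.Ventures.HodgeRepro.Tier4.Line4.L1ClosedCor

/-!
# Tier4/Line4/AdaptedONBClosedL1 — display (4) of Skeleton-v0.33 as GLUE: an adapted ONB with CLOSED constituents, stable
under `R(f)` for every `L¹` test `f`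

Blind re-derivation cell `pub-hodge-repro`, Tier 4 «prove the step» (README §9–§10), seat t4-L4-p2 (prover, LINE L4,
gen 4; cut C-L4-ONBCLOSED, plan-4 g4 S14955 (K2)).  Tree path
`lean/Summits/Ventures/HodgeRepro/Tier4/Line4/AdaptedONBClosedL1.lean`.  No `def`; 0 print consumed here — the two
print-shaped hypotheses of L4-p1's `exists_adaptedONB_adaptedC` (`hinf`: `L²(D_G)` is infinite-dimensional; `h4bC`: every
non-zero invariant subspace closed under `L²(D_G)`-limits of continuous invariant functions contains a non-zero closed
irreducible invariant subspace — the spectral theorem for the compact operators `R(f)` on the compact quotient, (4b))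
are DISPLAYED as binders, exactly as plan-4 states display (4).

`exists_adaptedONB_closed_underL1`: from L4-p1's `exists_adaptedONB_adaptedC` (AdaptedONBAdaptedClosed, with the trivial
block functor `Wfd := ⊥`) an adapted ONB `(τ, φ, n)` whose constituents `τ m` are closed (`IsClosedSub`), and then
L2-p2's `adaptedClosedUnderL1_of_isClosedSub` (L1ClosedCor p-L1CLOSED): the family is `AdaptedClosedUnderL1` — `R(f)` for
`f ∈ L¹ ∩ C⁰` preserves every `τ m`.  `exists_adaptedONB_closed_underL1_ofAdelicData` is the instance on
`Setting.ofAdelicData` (second countability, local and σ-compactness of `G(𝔸)` by name).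

Nothing here says anything about the status of the Hodge conjecture for CM abelian varieties, which is NOT proved
(HC_CM is NOT proved by anyone in this repository).
-/

set_option autoImplicit false

noncomputable section

namespace Summit.Ventures.HodgeRepro.Tier4.Line4

open MeasureTheory Summit.Ventures.HodgeRepro.Tier4.Common Summit.Ventures.HodgeRepro.Tier4.Line1
  Summit.Ventures.HodgeRepro.Tier4.Line1.RTF NumberField

section Generic

variable {G : Type} [Group G] [TopologicalSpace G] [IsTopologicalGroup G] [MeasurableSpace G] [BorelSpace G]
  (S : RTF.Setting G)

/-- **Display (4) as glue (generic)**: under `hinf` and the (4b) display `h4bC`, an adapted ONB whose constituents are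
closed and stable under `R(f)` for every `L¹` test `f`. -/
theorem exists_adaptedONB_closed_underL1 [SecondCountableTopology G] [LocallyCompactSpace G] [SigmaCompactSpace G]
    (hinf : ¬ FiniteDimensional ℂ (Lp ℂ 2 (S.μ.restrict S.DG)))
    (h4bC : ∀ V : Set (G → ℂ), S.IsInvariantSubspace V →
      (∀ ψ : G → ℂ, Continuous ψ → S.Invariant ψ →
        (∀ ε : ℝ, 0 < ε → ∃ ψ' ∈ V,
          eLpNorm (fun x => ψ x - ψ' x) 2 (S.μ.restrict S.DG) < ENNReal.ofReal ε) → ψ ∈ V) →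
      (∃ ψ ∈ V, ∃ x, ψ x ≠ 0) →
      ∃ V' : Set (G → ℂ), S.IsInvariantSubspace V' ∧ V' ⊆ V ∧ S.IsIrreducible V' ∧
        (∃ ψ ∈ V', ∃ x, ψ x ≠ 0) ∧ IsClosedSub S V') :
    ∃ (τ : ℕ → Set (G → ℂ)) (φ : ℕ → G → ℂ) (n : ℕ → ℕ), S.IsAdaptedONB τ φ n ∧
      (∀ m, IsClosedSub S (τ m)) ∧ L1Class.AdaptedClosedUnderL1 S τ := by
  obtain ⟨τ, φ, n, hB, hcl, -⟩ := exists_adaptedONB_adaptedC S hinf h4bC (fun _ => ⊥) fun V _ _ _ h0 =>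
    ⟨by rw [Submodule.bot_coe]; exact Set.singleton_subset_iff.mpr h0, inferInstance⟩
  exact ⟨τ, φ, n, hB, hcl, L1Class.adaptedClosedUnderL1_of_isClosedSub S τ (fun m => hB.inv m) hcl⟩

end Generic

section Adelic

variable {k : Type} [Field k] [NumberField k] (W : PlaneData k) [MeasurableSpace (GA W)] [BorelSpace (GA W)]
  (R : RTFData W) (μ : Measure (GA W)) [μ.IsHaarMeasure] [R.μT.IsHaarMeasure] [R.μT'.IsHaarMeasure]
  (DG : Set (GA W)) (fdG : IsFundamentalDomain (rationalPoints W) DG μ) (compG : IsCompact (closure DG))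
  (compT : IsCompact (closure R.DT)) (compT' : IsCompact (closure R.DT'))

/-- **Display (4) on `Setting.ofAdelicData`**: the generic glue with the topology of `G(𝔸)` supplied by name
(`secondCountable_GA`, `locallyCompact_GA`, `sigmaCompact_GA`). -/
theorem exists_adaptedONB_closed_underL1_ofAdelicData
    (hinf : ¬ FiniteDimensional ℂ (Lp ℂ 2 (μ.restrict DG)))
    (h4bC : ∀ V : Set (GA W → ℂ),
      (Setting.ofAdelicData W R μ DG fdG compG compT compT').IsInvariantSubspace V →
      (∀ ψ : GA W → ℂ, Continuous ψ → (Setting.ofAdelicData W R μ DG fdG compG compT compT').Invariant ψ →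
        (∀ ε : ℝ, 0 < ε → ∃ ψ' ∈ V,
          eLpNorm (fun x => ψ x - ψ' x) 2 (μ.restrict DG) < ENNReal.ofReal ε) → ψ ∈ V) →
      (∃ ψ ∈ V, ∃ x, ψ x ≠ 0) →
      ∃ V' : Set (GA W → ℂ), (Setting.ofAdelicData W R μ DG fdG compG compT compT').IsInvariantSubspace V' ∧
        V' ⊆ V ∧ (Setting.ofAdelicData W R μ DG fdG compG compT compT').IsIrreducible V' ∧
        (∃ ψ ∈ V', ∃ x, ψ x ≠ 0) ∧ IsClosedSub (Setting.ofAdelicData W R μ DG fdG compG compT compT') V') :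
    ∃ (τ : ℕ → Set (GA W → ℂ)) (φ : ℕ → GA W → ℂ) (n : ℕ → ℕ),
      (Setting.ofAdelicData W R μ DG fdG compG compT compT').IsAdaptedONB τ φ n ∧
      (∀ m, IsClosedSub (Setting.ofAdelicData W R μ DG fdG compG compT compT') (τ m)) ∧
      L1Class.AdaptedClosedUnderL1 (Setting.ofAdelicData W R μ DG fdG compG compT compT') τ := by
  haveI : SecondCountableTopology (GA W) := secondCountable_GA W
  haveI : LocallyCompactSpace (GA W) := locallyCompact_GA W
  haveI : SigmaCompactSpace (GA W) := sigmaCompact_GA W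
  exact exists_adaptedONB_closed_underL1 (Setting.ofAdelicData W R μ DG fdG compG compT compT') hinf h4bC

end Adelic

end Summit.Ventures.HodgeRepro.Tier4.Line4

end
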